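import Literature.MathematicalPhysics.QuantumFieldTheory.Balaban1983to89.Beta.RemainderDelta2TorusLocalSup
import Literature.MathematicalPhysics.QuantumFieldTheory.Balaban1983to89.Beta.RemainderHJBudgetTower
import Literature.MathematicalPhysics.QuantumFieldTheory.Balaban1983to89.B7Eq43AveragedSmallnessLevelFree

/-!
# T. Bałaban, *Propagators for lattice gauge theories in a background field*, Commun. Math. Phys. **99** (1985) 389–434 [Balaban1985BackgroundPropagators]
# (3.134)–(3.137) pp. 422–423: **BAŁABAN's `Δ⁽²⁾(U)` AT THE TOWER — THE JUNCTION**: «Y17b»'s `Δ⁽²⁾` of a coefficient field on the torus, AT the tower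
# `Ω_k = T_η` of NE9's model (`P = towerP L m (n+1)`, `U₀ =` the periodic extension of the tower background `U`, `η = L^{−(n+1)}`, `c₀ = η^d`), WITH print's
# coefficient `K = H̃_k\*J` (the Hilbert adjoint of NE9's `H̃_k = H1LatticeK hposπ hQ` for the (3.11) pairings, applied to the current `J` of (3.11), budget
# «Y14»), YIELDS THE `hD2` DISPLAY OF ROW (D4)'s NODE-D ENDs «Y13a∕b∕c» with `λ₀ = Λ·j₀` — print's (3.137) *«|(Δ⁽²⁾A)(b)| ≤ O(1)Mα₀(Lʲη)⁻²|A|»* at the top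
# level, `j₀ = O(α)` the current window (3.36) («Y17c», row (D4) OWNER lineage `b2b-balaban-beta-an4`, gen 114; OFFER O-an4-g113-1 DELIVERED on the
# cell's model)

CITATION HEADER (lean-in-tree rule 2026-08-18).  Audit cell `pub-balaban`, BINDER row (D4) (`RemainderConst` leaves for Bałaban's split), OWNER lineage
`b2b-balaban-beta-an4`, gen 114.  [Balaban1985BackgroundPropagators] (B9 = [5]; held `paper:balaban1985-cmp99-background-propagators`, journal page = PDF
page + 388) (3.11) p. 392, (3.15) p. 393, (3.36) p. 396, (3.126) p. 420, (3.133) p. 422, (3.134)–(3.137) pp. 422–423 (re-read first-hand this generation);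
[Balaban1985Averaging] (B7 = [4]) (52) p. 26, (136)–(138) p. 39, (141) p. 39, (145) p. 39, (149) p. 40, (155) p. 41; [Balaban1985Variational] (B11 = [15])
(45) p. 285, (103) p. 293 (`H̃`), (190) p. 308.  Composed BY NAME: «Y17b» `Beta.RemainderDelta2TorusLocalSup.exists_delta2_torus_of_coeff`, «Y14»
`Beta.RemainderHJBudgetTower.exists_HJ_budget_tower` (whose (K81) binder block — ne9-leaf-05's `B9Eq3126H1kPiSupRowClosed` — is repeated VERBATIM),
`B7Eq43AveragedSmallnessLevelFree.pdev_perCfg_le_of_plaq` ((52) from the plaquette window, as «Y12a»), `B9Eq316TowerFlatIsOneStep.towerP_eq_fineP_pow`.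
Nothing of print is asserted here.

WHY THIS FILE («Y17c»).  **`exists_delta2_tower`**: `∃ (α₁, j₁, Λ)` FIRST; then, under (K81)'s binder block VERBATIM (the tower data, the display `αU`, the
level profile, the background `U` with `star U = U⁻¹` in the window `‖U − 1‖ ≤ αη`, `‖U(∂p) − 1‖ ≤ αη²`, `α ≤ α₁`, transporters, `hpos′`, `hpos`, `hc₀η : c₀ = η^d`,
the CURRENT WINDOW `hJ : ‖J‖ ≤ j₀ ≤ j₁` — print's (3.36) —, `hposπ`, `hQ`) and with [4] Prop. 5's regime parameters `(α₀, β)` and smallnesses ((145), (155),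
`4β < c₃`, the `exp` condition; conditions on `d, L, α₀, β` ONLY, displayed at the top) : THERE IS a `ℂ`-linear `Δ⁽²⁾` on the fine `BondL2K` carrier such that
(i) **«Y13a»'s `hD2` display holds with `λ₀ = Λ·j₀` and `r_D = d`** — for every `A`, fine bond `b`, `F ≥ 0` bounding `‖A(b′)‖` on the bonds whose block is
within `d₁ ≤ d` of the block of `b`: `‖(Δ⁽²⁾ᵉA)(b)‖ ≤ Λ·j₀·F`; (ii) the polarised (3.134)∕(3.136) identity with `K(c) = φ((H̃_k†(φ⁻¹∘J))(c))`.  Mechanism: «Y17b»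
at `P := towerP L m (n+1)` (`hP := towerP_eq_fineP_pow`), `U₀ := perCfg U` (unitary by `star U = U⁻¹`; (52) at scale `n+1` from the plaquette window:
`pdev ≤ αη² ≤ (α₀∕2)η² < α₀(L^{n+1})⁻²` for `α ≤ α₁ ≤ α₀∕2`), witness radius `b := β·(L^{n+1})⁻¹`, `K_max := M_φ·B′·M_φ′·j₀` («Y14»), and the normalisations
`‖η‖L^{n+1} = 1`, `‖c₀‖(L^{n+1})^d = 1` collapsing «Y17b»'s `λ₀` to `Λ·j₀`, `Λ = M_φ′M_φ²·(2d)·M_τ·C₃·M_φ·2^d·(M_φB′M_φ′)`.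
WHAT THIS CLOSES: the LAST displayed analytic letter of NODE D at the origin («Y13a∕b∕c»'s `hD2`) is SUPPLIED on the cell's model by Bałaban's own `Δ⁽²⁾`
of (3.134) at the top level — modulo the displayed regime smallnesses of [4] Prop. 5 and the current window (3.36).

HONEST SCOPE.  Compositions BY NAME («Y17b», «Y14», `pdev_perCfg_le_of_plaq`) + real arithmetic; (K81)'s hypotheses and [4] Prop. 5's smallnesses stay
HYPOTHESES, displayed; `Δ⁽²⁾` here is the ONE-LEVEL (`j = k`) operator on the cell's MODEL carriers (NE9's tower), NOT Bałaban's multiscale `Δ⁽²⁾` on `𝔅`, NOT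
`Δ⁽²⁾_π` (3.135), NOT (3.138), NOT the identification with NE9's linear `Q_k(U)` beyond the shared periodic extension; constants crude.  Row (D4) class
UNCHANGED (instance 0∕1; critical-path width 0 = NODE O; D4 DISCHARGE NO DATE); NOT B12 Thm 2, NOT BetaPertH, NOT continuum, NOT Clay.  HONEST DEPENDENCY (cell
line): continuum YM on T⁴ ⇐ BetaPertH ∧ nine spine estimates (0/9 proved); BetaPertH ⇐ (D1) ∧ (D4) ∧ CAP+tail; G-an2-4 gates asym, D1 and NE2/3/4.  NEW file;
nothing modified; 0 `def`; standard axioms; no `sorry`; `maxHeartbeats 400000` on the one theorem (the (K81) binder block, as (K81) ∕ «Y14»).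
Net new unproved facts: 0.
-/

noncomputable section

set_option autoImplicit false

open scoped BigOperators InnerProductSpace ComplexConjugate

namespace Literature.MathematicalPhysics.QuantumFieldTheory.Balaban1983to89.Beta.RemainderDelta2Tower

open B9Eq311L2Pairing (WL2)
open B4Sect5Torus (TSite)
open B5TorusCover (UT)
open B9SectCLatticeCarrier (Bond bpos btgt unshift)
open B9Eq319QprimeTorus (fineP blockCoord)
open B7Prop1Explicit (U1 Wcx boxVec)
open B7Prop2Explicit (unitaryUnits pdev C0 c2')
open B7Prop3Flat (insCfg c3)
open B7Prop5Flat (restr)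
open B7Prop5GeneralInduction (CCovIter)
open B7Prop5GeneralLevels (thetaGen C3Gen)
open B12Ineq417Flat (boxBonds)
open B11Eq103H1Complex (SiteL2K BondL2K H1LatticeK)
open B9Eq310DeltaPrime (plaqHolU)
open B9Eq310HessianOperator (adTransportW)
open B9Eq315QTorus (perCfg perCfg_apply cornerSite)
open B9Eq315QTower (towerP UlevOf)
open B9Eq316TowerFlatIsOneStep (towerP_eq_fineP_pow siteCast)
open B9Eq326OperatorTower (QkW laplaceAk)
open B9Eq324DeltaPrimeATower (laplacePrimeAk)
open B9Eq3119DeltaPiTower (laplaceAkPi)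
open B9Thm37GlueTorus (tdist1)
open B7Eq43AveragedSmallnessLevelFree (pdev_perCfg_le_of_plaq)
open Beta.RemainderDelta2TorusLocalSup (exists_delta2_torus_of_coeff)
open Beta.RemainderHJBudgetTower (exists_HJ_budget_tower)

section Tower

variable {d : ℕ} (hd : 1 ≤ d) (L : ℕ) [NeZero L] (hL : 1 ≤ L) (hL3 : 3 ≤ L)
  {𝔸 : Type*} [CStarAlgebra 𝔸] [Nontrivial 𝔸]
  {W : Type*} [NormedAddCommGroup W] [InnerProductSpace ℂ W] [FiniteDimensional ℂ W] (φ : W ≃ₗ[ℂ] 𝔸)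
  {Mφ Mφ' : ℝ} (hMφ : 0 ≤ Mφ) (hMφ' : 0 ≤ Mφ') (hφ : ∀ w, ‖φ w‖ ≤ Mφ * ‖w‖) (hφ' : ∀ X, ‖φ.symm X‖ ≤ Mφ' * ‖X‖) (hstar : ∀ X : 𝔸, ‖star X‖ ≤ ‖X‖)
  {a : ℝ} (ha : 0 < a) {a' : ℝ} (ha' : 0 < a') {ϱ : ℝ} (hϱ0 : 0 ≤ ϱ) (hϱ1 : ϱ < 1)
  (τ : 𝔸 →ₗ[ℂ] ℂ) {Cτ : ℝ} (hτ : ∀ X, ‖τ X‖ ≤ Cτ * ‖X‖) (hCτ : 0 ≤ Cτ) {Mτ : ℝ} (hτm : ∀ X Y : 𝔸, ‖τ (X * Y)‖ ≤ Mτ * ‖X‖ * ‖Y‖) (hMτ : 0 ≤ Mτ)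
  {ρw : ℝ} (hρw : 0 ≤ ρw)
  (hτ₁ : ∀ X : 𝔸, τ (star X) = conj (τ X)) (hτ₂ : ∀ X Y : 𝔸, τ (X * Y) = τ (Y * X)) (hφτ : ∀ X Y : 𝔸, ⟪φ.symm X, φ.symm Y⟫_ℂ = τ (star X * Y))
  (AQ : ℝ)
  {α₀ β : ℝ} (hα : 0 < α₀) (hα3 : C0 d * α₀ ≤ 1 / 3) (hα4 : 4 * α₀ ≤ c2' d L) (hβ : 0 < β)
  (hsmall : Real.exp (4 * (800 * ((d : ℝ) + 1) ^ 2 * ((d : ℝ) + 4)) * α₀) * (1 + 8 * (131072 * ((d : ℝ) + 1) ^ 2) * β) ≤ 2)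
  (hc₃ : 4 * β < c3 d L)
  (h145 : 8 * d * thetaGen d L α₀ * (L : ℝ)⁻¹ ^ 4 ≤ 1)
  (h155 : (2 * (L : ℝ) - 1) * (L : ℝ)⁻¹ ^ 2 + 2 * d * thetaGen d L α₀ * (L : ℝ)⁻¹ ^ 3
    + 1 / 8 * (1 + 2 * d * thetaGen d L α₀ * (L : ℝ)⁻¹ ^ 2 + 2 * d * C3Gen d L * β) * (L : ℝ)⁻¹ ^ 2 ≤ 1)

set_option maxHeartbeats 400000 in
include hd hL hL3 hMφ hMφ' hφ hφ' hstar ha ha' hϱ0 hϱ1 hτ hCτ hτm hMτ hρw hτ₁ hτ₂ hφτ hα hα3 hα4 hβ hsmall hc₃ h145 h155 in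
/-- **BAŁABAN's `Δ⁽²⁾(U)` AT THE TOWER SUPPLIES ROW (D4)'s `hD2`** — see the module docstring: `∃ (α₁, j₁, Λ)` FIRST; under (K81)'s binder block and [4]
Prop. 5's displayed smallnesses, `∃ Δ⁽²⁾` on `BondL2K` with (i) «Y13a»'s (3.137) display at `λ₀ = Λ·j₀`, `r_D = d` and (ii) the polarised (3.134)∕(3.136)
identity with `K = φ(H̃_k†(φ⁻¹J))`. [cite: Balaban1985BackgroundPropagators, (3.134)–(3.137) pp.422–423, (3.36) p.396, (3.133) p.422, (3.11) p.392]
[cite: Balaban1985Averaging, (136)–(138) p.39, (149) p.40, (52) p.26, (145) p.39, (155) p.41] [cite: Balaban1985Variational, (45) p.285, (103) p.293] -/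
theorem exists_delta2_tower :
    ∃ α₁ j₁ Λ : ℝ, 0 < α₁ ∧ 0 < j₁ ∧ 0 ≤ Λ ∧
      ∀ (n : ℕ) (η : ℝ) (_hηL : η * (L : ℝ) ^ (n + 1) = 1) (c₀ c₁ : ℝ) [Fact (0 < c₀)] [Fact (0 < c₁)]
        (_hw : c₀ * ((L : ℝ) ^ (n + 1)) ^ d = c₁) (_hρ : |η| ^ d / c₀ ≤ ρw) (m : Fin d → ℕ) [∀ i, NeZero (m i)] (_hm : ∀ i, 1 ≤ m i)
        (U : Bond d (towerP L m (n + 1)) → 𝔸ˣ) (αU : ℕ → ℝ) (_hα0 : ∀ j, 0 ≤ αU j) (hα1 : ∀ j, αU j ≤ 1 / 64)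
        (hαL : ∀ j, 50 * (d + 1) * αU j * (L : ℝ) ^ d ≤ 1 / 2)
        (hU1 : ∀ (j : ℕ) (x : B7Prop1Explicit.Site d) (k : Fin d), perCfg (towerP L m (j + 1)) (UlevOf L m (n + 1) U j) x k ∈ U1 𝔸)
        (hreg : ∀ (j : ℕ) (y : TSite d (towerP L m j)) (k : Fin d) (ρ' : Fin d → Fin L),
          ‖((Wcx L (perCfg (towerP L m (j + 1)) (UlevOf L m (n + 1) U j)) (cornerSite L y) k (boxVec L ρ') : 𝔸ˣ) : 𝔸) - 1‖ ≤ αU j)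
        (εU : ℕ → ℝ) (_hεU : ∀ j, 0 ≤ εU j) (_hUε : ∀ (j : ℕ) (b : Bond d (towerP L m (j + 1))), ‖(UlevOf L m (n + 1) U j b : 𝔸) - 1‖ ≤ εU j)
        (_hLb : ∀ (j : ℕ) (b : Bond d (towerP L m (j + 1))), UlevOf L m (n + 1) U j b ∈ U1 𝔸)
        (α : ℝ) (_hα : 0 ≤ α) (_hαle : α ≤ α₁)
        (hUst : ∀ b, star (U b : 𝔸) = (((U b)⁻¹ : 𝔸ˣ) : 𝔸)) (_hUb : ∀ b, U b ∈ U1 𝔸) (_hUη : ∀ b, ‖(U b : 𝔸) - 1‖ ≤ α * η)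
        (_hpl : ∀ p : B9SectCLatticeCarrier.Plaq d (towerP L m (n + 1)), ‖(plaqHolU U p : 𝔸) - 1‖ ≤ α * η ^ 2)
        (_hUgrad : ∀ (x : TSite d (towerP L m (n + 1))) (μ : Fin d), ‖(U (x, μ) : 𝔸) - U (unshift μ x, μ)‖ ≤ α * η ^ 2)
        (_hRlev : ∀ (j : ℕ) (b : Bond d (towerP L m (j + 1))) (w : W), ‖adTransportW φ (UlevOf L m (n + 1) U j) b w‖ ≤ ‖w‖)
        (_hεg : ∀ j < n + 1, εU j ≤ α * ϱ ^ j) (_hAQ : ∑ j ∈ Finset.range (n + 1), αU j ≤ AQ)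
        (hpos' : ∀ x : SiteL2K ℂ d (towerP L m (n + 1)) c₀ W, x ≠ 0 → 0 < RCLike.re ⟪x, laplacePrimeAk L m n φ η U a' (c₁ := c₁) x⟫_ℂ)
        (hpos : ∀ x : BondL2K ℂ d (towerP L m (n + 1)) c₀ W, x ≠ 0 →
          0 < RCLike.re ⟪x, laplaceAk L m n φ η U hL αU hα1 hU1 hreg τ (c₀ := c₀) (c₁ := c₁) a x⟫_ℂ)
        (_hc₀η : c₀ = η ^ d) (j₀ : ℝ) (_hJ : ∀ μ y, ‖B9Eq39Adjoint.J (fun μ => B9Eq33CovDerivVector.shiftEquiv μ) (fun μ y => U (y, μ)) η μ y‖ ≤ j₀) (_hj : j₀ ≤ j₁)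
        (hposπ : ∀ x : BondL2K ℂ d (towerP L m (n + 1)) c₀ W, x ≠ 0 →
          0 < RCLike.re ⟪x, laplaceAkPi L m n φ τ η U a' hpos' hL αU hα1 hU1 hreg (c₁ := c₁) a x⟫_ℂ)
        (hQ : Function.Surjective (QkW L m n φ U hL αU hα1 hU1 hreg (c₀ := c₀) (c₁ := c₁))),
        ∃ D2 : BondL2K ℂ d (towerP L m (n + 1)) c₀ W →ₗ[ℂ] BondL2K ℂ d (towerP L m (n + 1)) c₀ W,
          -- (3.137) IN THE SHAPE OF «Y13a»'s `hD2` (`λ₀ = Λ·j₀`, `r_D = d`)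
          (∀ (A : Bond d (towerP L m (n + 1)) → W) (b : Bond d (towerP L m (n + 1))) (F : ℝ), 0 ≤ F →
            (∀ b' : Bond d (towerP L m (n + 1)),
              tdist1 m (UT.ofSite m (blockCoord (L ^ (n + 1)) m (siteCast (towerP_eq_fineP_pow L m (n + 1)) (bpos b))))
                (UT.ofSite m (blockCoord (L ^ (n + 1)) m (siteCast (towerP_eq_fineP_pow L m (n + 1)) (bpos b')))) ≤ d → ‖A b'‖ ≤ F) →
            ‖((WL2.linearEquiv ℂ ℂ (fun _ : Bond d (towerP L m (n + 1)) => c₀) :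
            BondL2K ℂ d (towerP L m (n + 1)) c₀ W ≃ₗ[ℂ] (Bond d (towerP L m (n + 1)) → W)).toLinearMap ∘ₗ D2 ∘ₗ
                (WL2.linearEquiv ℂ ℂ (fun _ : Bond d (towerP L m (n + 1)) => c₀) :
            BondL2K ℂ d (towerP L m (n + 1)) c₀ W ≃ₗ[ℂ] (Bond d (towerP L m (n + 1)) → W)).symm.toLinearMap) A b‖ ≤ Λ * j₀ * F) ∧
          -- (3.134) ∕ (3.136) POLARISED with `K = φ(H̃_k†(φ⁻¹J))`, `H̃_k† = (H1LatticeK hposπ hQ)†`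
          (∀ A δA : Bond d (towerP L m (n + 1)) → W,
            ∑ b : Bond d (towerP L m (n + 1)), (c₀ : ℂ) * τ (φ (δA b) * φ (((WL2.linearEquiv ℂ ℂ (fun _ : Bond d (towerP L m (n + 1)) => c₀) :
            BondL2K ℂ d (towerP L m (n + 1)) c₀ W ≃ₗ[ℂ] (Bond d (towerP L m (n + 1)) → W)).toLinearMap ∘ₗ D2 ∘ₗ
                (WL2.linearEquiv ℂ ℂ (fun _ : Bond d (towerP L m (n + 1)) => c₀) :
            BondL2K ℂ d (towerP L m (n + 1)) c₀ W ≃ₗ[ℂ] (Bond d (towerP L m (n + 1)) → W)).symm.toLinearMap) A b)) =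
              ∑ c : Bond d m, τ
                (fderiv ℂ (fderiv ℂ (fun a' : ↥(boxBonds L (n + 1) (fun i => ((c.1 i : ℕ) : ℤ)) c.2) → 𝔸 =>
                    CCovIter L (perCfg (towerP L m (n + 1)) U) (insCfg (boxBonds L (n + 1) (fun i => ((c.1 i : ℕ) : ℤ)) c.2) a') (n + 1)
                      (fun i => ((c.1 i : ℕ) : ℤ)) c.2)) 0
                  (restr (boxBonds L (n + 1) (fun i => ((c.1 i : ℕ) : ℤ)) c.2) (perCfg (towerP L m (n + 1)) fun b => (η : ℂ) • φ (A b)))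
                  (restr (boxBonds L (n + 1) (fun i => ((c.1 i : ℕ) : ℤ)) c.2) (perCfg (towerP L m (n + 1)) fun b => (η : ℂ) • φ (δA b))) *
                  φ (WL2.equiv ℂ (fun _ : Bond d m => c₁) W
                    (LinearMap.adjoint (H1LatticeK hposπ hQ)
                      ((WL2.equiv ℂ (fun _ : Bond d (towerP L m (n + 1)) => c₀) W).symm fun b =>
                        φ.symm (B9Eq39Adjoint.J (fun μ => B9Eq33CovDerivVector.shiftEquiv μ) (fun μ y => U (y, μ)) η b.2 b.1))) c))) := by
  classical
  obtain ⟨αA, jA, B', hαA, hjA, hB', HJ⟩ :=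
    exists_HJ_budget_tower hd L hL hL3 φ hMφ hMφ' hφ hφ' hstar ha ha' hϱ0 hϱ1 τ hτ hCτ hτm hMτ hρw hτ₁ hτ₂ hφτ AQ
  -- the constant
  obtain ⟨Λ, hΛ0, hΛ⟩ : ∃ Λ : ℝ, 0 ≤ Λ ∧
      Λ = Mφ' * Mφ ^ 2 * ((2 * d) * (Mτ * (C3Gen d L * Mφ * 2 ^ d) * (Mφ * B' * Mφ'))) := by
    refine ⟨_, ?_, rfl⟩
    have : 0 ≤ C3Gen d L := by unfold C3Gen B7Prop5GeneralLevels.C1ppGen; positivity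
    positivity
  refine ⟨min αA (α₀ / 2), jA, Λ, lt_min hαA (by positivity), hjA, hΛ0, ?_⟩
  intro n η hηL c₀ c₁ _ _ hw hρ m _ hm U αU hα0 hα1 hαL hU1 hreg εU hεU hUε hLb α hα' hαle hUst hUb hUη hpl hUgrad hRlev hεg hAQ hpos' hpos hc₀η j₀ hJ hj
    hposπ hQ
  have hL2 : 2 ≤ L := le_trans (by norm_num) hL3
  have hL1 : 1 ≤ L := hL
  have hc₀ : (0 : ℝ) < c₀ := Fact.out
  have hLk : (0 : ℝ) < (L : ℝ) ^ (n + 1) := by positivity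
  have hη : η = ((L : ℝ) ^ (n + 1))⁻¹ := by
    field_simp; linarith [hηL]
  have hη0 : 0 < η := by rw [hη]; positivity
  have hαA' : α ≤ αA := hαle.trans (min_le_left _ _)
  have hα02 : α ≤ α₀ / 2 := hαle.trans (min_le_right _ _)
  -- the current as a fine `W`-valued field and the coefficient `K = φ(H̃_k†(φ⁻¹J))`
  set f : BondL2K ℂ d (towerP L m (n + 1)) c₀ W := (WL2.equiv ℂ (fun _ : Bond d (towerP L m (n + 1)) => c₀) W).symm fun b =>
    φ.symm (B9Eq39Adjoint.J (fun μ => B9Eq33CovDerivVector.shiftEquiv μ) (fun μ y => U (y, μ)) η b.2 b.1) with hf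
  have hfF : ∀ b, ‖WL2.equiv ℂ (fun _ : Bond d (towerP L m (n + 1)) => c₀) W f b‖ ≤ Mφ' * j₀ := fun b => by
    rw [hf, Equiv.apply_symm_apply]
    exact (hφ' _).trans (mul_le_mul_of_nonneg_left (hJ _ _) hMφ')
  have hj0 : 0 ≤ j₀ := (norm_nonneg _).trans (hJ ⟨0, hd⟩ (fun i => 0))
  set K : Bond d m → 𝔸 := fun c =>
    φ (WL2.equiv ℂ (fun _ : Bond d m => c₁) W (LinearMap.adjoint (H1LatticeK hposπ hQ) f) c) with hK
  have hKb : ∀ c, ‖K c‖ ≤ Mφ * B' * Mφ' * j₀ := fun c => by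
    rw [hK]
    refine (hφ _).trans ?_
    have h := HJ n η hηL c₀ c₁ hw hρ m hm U αU hα0 hα1 hαL hU1 hreg εU hεU hUε hLb α hα' hαA' hUst hUb hUη hpl hUgrad hRlev hεg hAQ hpos' hpos hc₀η j₀
      hJ hj hposπ hQ f (Mφ' * j₀) hfF c
    calc Mφ * ‖WL2.equiv ℂ (fun _ : Bond d m => c₁) W (LinearMap.adjoint (H1LatticeK hposπ hQ) f) c‖ ≤ Mφ * (B' * (Mφ' * j₀)) :=
          mul_le_mul_of_nonneg_left h hMφ
      _ = Mφ * B' * Mφ' * j₀ := by ring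
  -- [4] Prop. 5's regime at the periodic extension of `U`
  have hU₀ : ∀ x κ, perCfg (towerP L m (n + 1)) U x κ ∈ unitaryUnits 𝔸 := by
    intro x κ
    rw [perCfg_apply, B7Prop2Explicit.mem_unitaryUnits, Unitary.mem_iff]
    have hs := hUst (B9Eq315QTorus.perSite (towerP L m (n + 1)) x, κ)
    constructor
    · rw [hs, Units.inv_mul]
    · rw [hs, Units.mul_inv]
  have h52 : pdev (perCfg (towerP L m (n + 1)) U) < α₀ * (((L : ℝ) ^ (n + 1))⁻¹) ^ 2 := by
    have hpd : pdev (perCfg (towerP L m (n + 1)) U) ≤ α * η ^ 2 := pdev_perCfg_le_of_plaq (U := U) hUb (by positivity) hpl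
    have h1 : α * η ^ 2 ≤ α₀ / 2 * η ^ 2 := mul_le_mul_of_nonneg_right hα02 (by positivity)
    have h2 : α₀ / 2 * η ^ 2 < α₀ * η ^ 2 := by
      have : 0 < η ^ 2 := by positivity
      nlinarith
    rw [← hη]; linarith
  have hb : (0 : ℝ) < β * ((L : ℝ) ^ (n + 1))⁻¹ := by positivity
  have hβ' : (L : ℝ) ^ (n + 1) * (β * ((L : ℝ) ^ (n + 1))⁻¹) = β := by field_simp
  -- «Y17b» at the tower
  obtain ⟨D2f, hid, hbd⟩ := exists_delta2_torus_of_coeff L hL2 (n + 1) (perCfg (towerP L m (n + 1)) U) hU₀ hα hα3 hα4 h52 hb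
    (by rw [hβ']; exact hsmall) (by rw [hβ']; exact hc₃) h145 (by rw [hβ']; exact h155) m hm (towerP L m (n + 1)) (towerP_eq_fineP_pow L m (n + 1))
    φ hMφ hMφ' hφ hφ' τ hτm hMτ hτ₂ hφτ (η : ℂ) (c₀ : ℂ) (by exact_mod_cast hc₀.ne') K (by positivity) hKb
  refine ⟨(WL2.linearEquiv ℂ ℂ (fun _ : Bond d (towerP L m (n + 1)) => c₀)).symm.toLinearMap ∘ₗ D2f ∘ₗ
      (WL2.linearEquiv ℂ ℂ (fun _ : Bond d (towerP L m (n + 1)) => c₀)).toLinearMap, ?_, ?_⟩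
  · intro A b F hF hA
    have hred : ((WL2.linearEquiv ℂ ℂ (fun _ : Bond d (towerP L m (n + 1)) => c₀) :
          BondL2K ℂ d (towerP L m (n + 1)) c₀ W ≃ₗ[ℂ] (Bond d (towerP L m (n + 1)) → W)).toLinearMap ∘ₗ
        ((WL2.linearEquiv ℂ ℂ (fun _ : Bond d (towerP L m (n + 1)) => c₀)).symm.toLinearMap ∘ₗ D2f ∘ₗ
          (WL2.linearEquiv ℂ ℂ (fun _ : Bond d (towerP L m (n + 1)) => c₀)).toLinearMap) ∘ₗ
        (WL2.linearEquiv ℂ ℂ (fun _ : Bond d (towerP L m (n + 1)) => c₀) :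
          BondL2K ℂ d (towerP L m (n + 1)) c₀ W ≃ₗ[ℂ] (Bond d (towerP L m (n + 1)) → W)).symm.toLinearMap) A b = D2f A b := by
      simp
    rw [hred]
    refine (hbd A b F hF hA).trans ?_
    -- the constant at the tower's normalisations `η·L^{n+1} = 1`, `c₀ = η^d`
    have hηn : ‖(η : ℂ)‖ = η := by rw [Complex.norm_real, Real.norm_eq_abs, abs_of_pos hη0]
    have hc₀n : ‖(c₀ : ℂ)‖ = η ^ d := by rw [Complex.norm_real, Real.norm_eq_abs, abs_of_pos hc₀, hc₀η]
    rw [hηn, hc₀n, hη, hΛ]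
    have hL0 : (L : ℝ) ^ (n + 1) ≠ 0 := hLk.ne'
    have key : ((((L : ℝ) ^ (n + 1))⁻¹) ^ d)⁻¹ * Mφ' * Mφ ^ 2 * ((2 * d) * (Mτ * (C3Gen d L * ((L : ℝ) ^ (n + 1)) ^ 2 *
        (((L : ℝ) ^ (n + 1))⁻¹ * Mφ) * ((((L : ℝ) ^ (n + 1)) ^ d)⁻¹ * 2 ^ d * ((L : ℝ) ^ (n + 1))⁻¹)) * (Mφ * B' * Mφ' * j₀))) =
        Mφ' * Mφ ^ 2 * ((2 * d) * (Mτ * (C3Gen d L * Mφ * 2 ^ d) * (Mφ * B' * Mφ'))) * j₀ := by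
      rw [inv_pow, inv_inv]
      have hLd : ((L : ℝ) ^ (n + 1)) ^ d ≠ 0 := pow_ne_zero _ hL0
      field_simp
    rw [key]
  · intro A δA
    have hred : ∀ A' : Bond d (towerP L m (n + 1)) → W, ((WL2.linearEquiv ℂ ℂ (fun _ : Bond d (towerP L m (n + 1)) => c₀) :
          BondL2K ℂ d (towerP L m (n + 1)) c₀ W ≃ₗ[ℂ] (Bond d (towerP L m (n + 1)) → W)).toLinearMap ∘ₗ
        ((WL2.linearEquiv ℂ ℂ (fun _ : Bond d (towerP L m (n + 1)) => c₀)).symm.toLinearMap ∘ₗ D2f ∘ₗ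
          (WL2.linearEquiv ℂ ℂ (fun _ : Bond d (towerP L m (n + 1)) => c₀)).toLinearMap) ∘ₗ
        (WL2.linearEquiv ℂ ℂ (fun _ : Bond d (towerP L m (n + 1)) => c₀) :
          BondL2K ℂ d (towerP L m (n + 1)) c₀ W ≃ₗ[ℂ] (Bond d (towerP L m (n + 1)) → W)).symm.toLinearMap) A' = D2f A' := by
      intro A'; ext b; simp
    simp_rw [hred]
    exact hid A δA

end Tower

end Literature.MathematicalPhysics.QuantumFieldTheory.Balaban1983to89.Beta.RemainderDelta2Tower

end
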